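import Mathlib
import Summits.Ventures.HodgeRepro0.P1FermatCertDefs

/-!
# p1 — Shioda per-class certificates, part 3 (m ∈ [68])
One `decide`d instance of `IsShiodaCert` per decomposable balanced family S of a CLOSED primitive degenerate Fermat CM type
Φ_(a,b) on ℚ(ζ_m) (proofs/p1-lattice-calculus.md §4d, (X22); Shioda 1981 Thm 4.3 + Lemma 4.2 make each family algebraic).
-/

namespace HodgeRepro0.P1.FermatCert

/-- m = 68, Φ = Φ_(1,24), family (|S| = 16) -/
theorem m68_1_24_s3_7_11_16 : IsShiodaCert 68 [1, 3, 5, 7, 9, 13, 15, 19, 21, 23, 27, 29, 35, 37, 43, 57] [3, 7, 11, 15, 19, 23, 27, 31, 35, 39, 43, 47, 55, 59, 63, 67] [1, 24, 43] [[3, 65], [4, 64], [61, 7], [67, 1], [44, 24], [25, 43], [35, 33], [9, 59], [39, 29], [52, 16], [45, 23], [32, 36], [56, 12], [21, 47], [13, 55], [11, 57], [60, 8], [15, 53], [20, 48], [40, 28], [49, 19], [37, 31], [27, 41], [5, 63]] := by decide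

/-- m = 68, Φ = Φ_(1,24), family (|S| = 16) -/
theorem m68_1_24_s5_15_19_16 : IsShiodaCert 68 [1, 3, 5, 7, 9, 13, 15, 19, 21, 23, 27, 29, 35, 37, 43, 57] [5, 15, 19, 29, 35, 37, 41, 43, 45, 47, 55, 57, 59, 61, 65, 67] [1, 24, 43] [[65, 3], [64, 4], [7, 61], [35, 33], [24, 44], [9, 59], [67, 1], [25, 43], [5, 63], [52, 16], [11, 57], [37, 31], [27, 41], [32, 36], [12, 56], [13, 55], [45, 23], [60, 8], [15, 53], [20, 48], [47, 21], [40, 28], [49, 19], [39, 29]] := by decide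

end HodgeRepro0.P1.FermatCert
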